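import Summits.Ventures.PercRepro.C026HubPairCheck

/-!
# Hub-pair graphs, VI: the D-free inequality on a pair gadget and on a single hub (p5, gen 11)

* **`dFreeIneq_of_injOn`** — the bookkeeping: an injection of the `KL` sources (`bot`, `a ~_H b`,
  neither `o1` nor `o2`) into the configurations of score `+1` (`bot`, `o1 ∨ o2`, `BAD → o1 ∧ o2`)
  gives the D-free inequality in its H-graph form `dFreeIneq_iff_hGraph`;
* **`dFreeIneq_of_chk`** — on a supported graph (marks `ι 0, ι 1, ι 2`), if every `bot` configuration
  passes the check `chk n` on its rows, the rotation `psi` is such an injection (its image by the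
  transfer lemmas and `oRows_psi` / `cRows_psi`; injective by `dec_psi`);
* **`dFreeIneq_of_supported5`**, **`dFreeIneq_of_supported4`** — the pair gadget (five supported
  vertices, every edge at a non-mark) and the single hub (four): the rows of a configuration are
  `pairRows` / `hubRows` of its class bits, so `chk5_all` / `chk4_all` apply.
-/

namespace PercRepro

namespace MultiGraph

open PairModel

variable {V E : Type*} {G : MultiGraph V E}

/-! ### Bookkeeping -/

/-- The pointwise count inequality behind `dFreeIneq_of_injOn`. -/
theorem count_aux (bot B O1 O2 : Prop) [Decidable bot] [Decidable B] [Decidable O1]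
    [Decidable O2] :
    (if bot ∧ B then 1 else 0) + (if bot ∧ (O1 ∨ O2) ∧ (B → O1 ∧ O2) then 1 else 0) ≤
      (if bot ∧ O1 then 1 else 0) + (if bot ∧ O2 then 1 else 0) +
        (if bot ∧ B ∧ ¬ O1 ∧ ¬ O2 then 1 else 0) := by
  by_cases hb : bot <;> by_cases hB : B <;> by_cases h1 : O1 <;> by_cases h2 : O2 <;>
    simp [hb, hB, h1, h2]

open Classical in
/-- **An injection of the `KL` sources into the score-`+1` configurations gives the D-free
inequality.** -/
theorem dFreeIneq_of_injOn [Fintype E] [DecidableEq E] (a b c : V) (Ψ : Config E → Config E)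
    (hmaps : ∀ ω, G.IsBot ω a b c → G.HConn ω c a b →
      ¬ G.HConnAvoid ω c (G.cluster ω b) c a → ¬ G.HConnAvoid ω c (G.cluster ω a) c b →
        G.IsBot (Ψ ω) a b c ∧
          (G.HConnAvoid (Ψ ω) c (G.cluster (Ψ ω) b) c a ∨
            G.HConnAvoid (Ψ ω) c (G.cluster (Ψ ω) a) c b) ∧
          (G.HConn (Ψ ω) c a b →
            G.HConnAvoid (Ψ ω) c (G.cluster (Ψ ω) b) c a ∧
              G.HConnAvoid (Ψ ω) c (G.cluster (Ψ ω) a) c b))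
    (hinj : Set.InjOn Ψ {ω | G.IsBot ω a b c ∧ G.HConn ω c a b ∧
      ¬ G.HConnAvoid ω c (G.cluster ω b) c a ∧ ¬ G.HConnAvoid ω c (G.cluster ω a) c b}) :
    G.DFreeIneq a b c := by
  rw [dFreeIneq_iff_hGraph]
  set KL := Finset.univ.filter fun ω : Config E => G.IsBot ω a b c ∧ G.HConn ω c a b ∧
    ¬ G.HConnAvoid ω c (G.cluster ω b) c a ∧ ¬ G.HConnAvoid ω c (G.cluster ω a) c b with hKL
  set P1 := Finset.univ.filter fun ω : Config E => G.IsBot ω a b c ∧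
    (G.HConnAvoid ω c (G.cluster ω b) c a ∨ G.HConnAvoid ω c (G.cluster ω a) c b) ∧
      (G.HConn ω c a b →
        G.HConnAvoid ω c (G.cluster ω b) c a ∧ G.HConnAvoid ω c (G.cluster ω a) c b) with hP1
  have hcard : KL.card ≤ P1.card := by
    refine Finset.card_le_card_of_injOn Ψ (fun ω hω => ?_) (fun ω₁ hω₁ ω₂ hω₂ h => ?_)
    · simp only [hKL, hP1, Finset.coe_filter, Finset.mem_univ, true_and, Set.mem_setOf_eq] at hω ⊢
      exact hmaps ω hω.1 hω.2.1 hω.2.2.1 hω.2.2.2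
    · simp only [hKL, Finset.coe_filter, Finset.mem_univ, true_and] at hω₁ hω₂
      exact hinj hω₁ hω₂ h
  have hsum : (Finset.univ.filter fun ω : Config E => G.IsBot ω a b c ∧ G.HConn ω c a b).card +
      P1.card ≤
      (Finset.univ.filter fun ω : Config E =>
        G.IsBot ω a b c ∧ G.HConnAvoid ω c (G.cluster ω b) c a).card +
        (Finset.univ.filter fun ω : Config E =>
          G.IsBot ω a b c ∧ G.HConnAvoid ω c (G.cluster ω a) c b).card + KL.card := by
    simp only [hP1, hKL, Finset.card_filter, ← Finset.sum_add_distrib]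
    exact Finset.sum_le_sum fun ω _ => count_aux _ _ _ _
  omega

/-! ### The rotation on a supported graph -/

variable {ι : ℕ → V} {n : ℕ} (hsup : G.Supported ι n) (hinj : InjBelow ι n) (hn : 2 < n)
include hsup hinj hn

/-- A `KL` source has `isKL` rows. -/
theorem isKL_of_source {ω : Config E} (hbot : G.IsBot ω (ι 0) (ι 1) (ι 2))
    (hbad : G.HConn ω (ι 2) (ι 0) (ι 1))
    (ho1 : ¬ G.HConnAvoid ω (ι 2) (G.cluster ω (ι 1)) (ι 2) (ι 0))
    (ho2 : ¬ G.HConnAvoid ω (ι 2) (G.cluster ω (ι 0)) (ι 2) (ι 1)) :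
    isKL n (G.oRows ι n ω) (G.cRows ι n ω) = true := by
  rw [isBot_iff_botB hsup hinj hn] at hbot
  rw [hConn_ab_iff_badB hsup hinj hn] at hbad
  rw [hConnAvoid_ca_iff_o1B hsup hinj hn] at ho1
  rw [hConnAvoid_cb_iff_o2B hsup hinj hn] at ho2
  simp [isKL, hbot, hbad, ho1, ho2]

/-- **The check gives the D-free inequality**: if every `bot` configuration of a supported graph
passes `chk n` on its rows, the rotation injects the `KL` sources into the score-`+1`
configurations. -/
theorem dFreeIneq_of_chk [Fintype E] [DecidableEq E]
    (hchk : ∀ ω : Config E, G.IsBot ω (ι 0) (ι 1) (ι 2) →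
      chk n (G.oRows ι n ω) (G.cRows ι n ω) = true) :
    G.DFreeIneq (ι 0) (ι 1) (ι 2) := by
  classical
  -- the facts of the check, for a `KL` source
  have key : ∀ ω : Config E, G.IsBot ω (ι 0) (ι 1) (ι 2) → G.HConn ω (ι 2) (ι 0) (ι 1) →
      ¬ G.HConnAvoid ω (ι 2) (G.cluster ω (ι 1)) (ι 2) (ι 0) →
      ¬ G.HConnAvoid ω (ι 2) (G.cluster ω (ι 0)) (ι 2) (ι 1) →
      chkImg n (G.oRows ι n ω) (G.cRows ι n ω) (imgO n (G.oRows ι n ω) (G.cRows ι n ω))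
        (imgC n (G.oRows ι n ω) (G.cRows ι n ω)) = true := by
    intro ω hbot hbad ho1 ho2
    have h := hchk ω hbot
    unfold chk at h
    rw [isKL_of_source hsup hinj hn hbot hbad ho1 ho2] at h
    simpa using h
  refine dFreeIneq_of_injOn (ι 0) (ι 1) (ι 2) (G.psi ι n) ?_ ?_
  · intro ω hbot hbad ho1 ho2
    have h := key ω hbot hbad ho1 ho2
    unfold chkImg at h
    rw [← oRows_psi hinj, ← cRows_psi hinj] at h
    simp only [Bool.and_eq_true, Bool.or_eq_true, Bool.not_eq_true'] at h
    obtain ⟨⟨⟨⟨⟨hb, ho⟩, hs⟩, _⟩, _⟩, _⟩ := h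
    refine ⟨(isBot_iff_botB hsup hinj hn).2 hb, ?_, ?_⟩
    · rw [hConnAvoid_ca_iff_o1B hsup hinj hn, hConnAvoid_cb_iff_o2B hsup hinj hn]
      exact ho
    · intro hbad'
      rw [hConn_ab_iff_badB hsup hinj hn] at hbad'
      rw [hConnAvoid_ca_iff_o1B hsup hinj hn, hConnAvoid_cb_iff_o2B hsup hinj hn]
      rcases hs with hs | hs
      · exact absurd hbad' (by simp [hs])
      · exact hs
  · intro ω₁ hω₁ ω₂ hω₂ heq
    simp only [Set.mem_setOf_eq] at hω₁ hω₂
    have hdec : ∀ ω, G.IsBot ω (ι 0) (ι 1) (ι 2) → G.HConn ω (ι 2) (ι 0) (ι 1) →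
        ¬ G.HConnAvoid ω (ι 2) (G.cluster ω (ι 1)) (ι 2) (ι 0) →
        ¬ G.HConnAvoid ω (ι 2) (G.cluster ω (ι 0)) (ι 2) (ι 1) →
        G.dec ι n (G.psi ι n ω) = ω := by
      intro ω hbot hbad ho1 ho2
      have h := key ω hbot hbad ho1 ho2
      unfold chkImg at h
      simp only [Bool.and_eq_true, List.all_eq_true, List.mem_range, Bool.or_eq_true,
        Bool.not_eq_true', beq_iff_eq] at h
      obtain ⟨⟨⟨⟨⟨_, _⟩, _⟩, hrot⟩, hdet1⟩, hdet2⟩ := h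
      refine dec_psi hsup hinj hn hrot (fun i hi hr => ?_) (fun p hp q hq hnp hnq hpq hrp hrq => ?_)
      · rcases hdet1 i hi with h | h
        · exact absurd hr (by simp [h])
        · exact ⟨h.1.1, h.1.2, h.2⟩
      · rcases hdet2 p hp q hq with h | h
        · exfalso
          simp [hnp, hnq, hpq, hrp, hrq] at h
        · refine ⟨fun hc => ?_, fun hc => ?_⟩
          · rcases h.1 with h' | h'
            · exact absurd hc (by simp [h'])
            · exact h'
          · rcases h.2 with h' | h'
            · exact absurd hc (by simp [h'])
            · exact h'
    calc ω₁ = G.dec ι n (G.psi ι n ω₁) := (hdec ω₁ hω₁.1 hω₁.2.1 hω₁.2.2.1 hω₁.2.2.2).symm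
      _ = G.dec ι n (G.psi ι n ω₂) := by rw [heq]
      _ = ω₂ := hdec ω₂ hω₂.1 hω₂.2.1 hω₂.2.2.1 hω₂.2.2.2

/-! ### The pair gadget and the single hub -/

omit hsup hinj hn in
/-- `maskOf n p < 2 ^ n`. -/
theorem maskOf_lt (n : ℕ) (p : ℕ → Bool) : maskOf n p < 2 ^ n := by
  induction n with
  | zero => simp [maskOf]
  | succ n ih =>
    simp only [maskOf]
    refine Nat.or_lt_two_pow ?_ (ih.trans (Nat.pow_lt_pow_right (by norm_num) (Nat.lt_succ_self n)))
    split_ifs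
    · exact Nat.pow_lt_pow_right (by norm_num) (Nat.lt_succ_self n)
    · exact Nat.two_pow_pos _

omit hsup hinj hn in
/-- The diagonal of the open rows is empty. -/
theorem adj_oRows_self (ω : Config E) (i : ℕ) : adj (G.oRows ι n ω) i i = false := by
  by_cases hi : i < n
  · cases h : adj (G.oRows ι n ω) i i
    · rfl
    · exact absurd ((adj_oRows ω hi i).1 h).2.1 (fun h => h rfl)
  · simp [adj, oRows, row_map_range_of_le (Nat.not_lt.mp hi)]

omit hsup hinj hn in
/-- The diagonal of the closed rows is empty. -/
theorem adj_cRows_self (ω : Config E) (i : ℕ) : adj (G.cRows ι n ω) i i = false := by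
  by_cases hi : i < n
  · cases h : adj (G.cRows ι n ω) i i
    · rfl
    · exact absurd ((adj_cRows ω hi i).1 h).2.1 (fun h => h rfl)
  · simp [adj, cRows, row_map_range_of_le (Nat.not_lt.mp hi)]

omit hsup hinj hn in
open Classical in
/-- An entry of the open rows below `n`, as a `decide`. -/
theorem adj_oRows_eq_decide (ω : Config E) {i j : ℕ} (hi : i < n) (hj : j < n) :
    adj (G.oRows ι n ω) i j = decide (i ≠ j ∧ ∃ e, ω e = true ∧ G.Joins e (ι i) (ι j)) := by
  classical
  simp [adj, oRows, row_map_range hi, testBit_maskOf, hj]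

omit hsup hinj hn in
open Classical in
/-- An entry of the closed rows below `n`, as a `decide`. -/
theorem adj_cRows_eq_decide (ω : Config E) {i j : ℕ} (hi : i < n) (hj : j < n) :
    adj (G.cRows ι n ω) i j = decide (i ≠ j ∧ ∃ e, ω e = false ∧ G.Joins e (ι i) (ι j)) := by
  classical
  simp [adj, cRows, row_map_range hi, testBit_maskOf, hj]

/-- The class bits of rows on five vertices. -/
def enc5 (R : Rows) : ℕ :=
  maskOf 7 fun t => [adj R 0 3, adj R 1 3, adj R 2 3, adj R 0 4, adj R 1 4, adj R 2 4,
    adj R 3 4].getD t false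

/-- The class bits of rows on four vertices. -/
def enc4 (R : Rows) : ℕ := maskOf 3 fun t => [adj R 0 3, adj R 1 3, adj R 2 3].getD t false

omit hsup hinj hn in
/-- **Rows on five vertices are `pairRows` of their class bits** when the diagonal and the mark–mark
entries are empty and the rows are symmetric. -/
theorem rows_eq_rows5 (R : Rows) (hR : R = (List.range 5).map fun i => maskOf 5 fun j => adj R i j)
    (hdiag : ∀ i, adj R i i = false) (hmm : ∀ i < 3, ∀ j < 3, adj R i j = false)
    (hsymm : ∀ i < 5, ∀ j < 5, adj R i j = adj R j i) : R = pairRows (enc5 R) := by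
  rw [hR]
  unfold pairRows
  refine List.map_congr_left fun i hi => maskOf_congr fun j hj => ?_
  rw [List.mem_range] at hi
  have key : ∀ i < 5, ∀ j < 5, adj R i j = bitOfClass5 (enc5 R) i j := by
    intro i hi j hj
    interval_cases i <;> interval_cases j <;>
      first
      | exact hdiag _
      | exact hmm _ (by omega) _ (by omega)
      | (simp only [bitOfClass5, enc5, testBit_maskOf]; simp; exact hsymm _ (by omega) _ (by omega))
      | (simp only [bitOfClass5, enc5, testBit_maskOf]; simp)
  rw [← hR]
  exact key i hi j hj

omit hsup hinj hn in
/-- **Rows on four vertices are `hubRows` of their class bits.** -/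
theorem rows_eq_rows4 (R : Rows) (hR : R = (List.range 4).map fun i => maskOf 4 fun j => adj R i j)
    (hdiag : ∀ i, adj R i i = false) (hmm : ∀ i < 3, ∀ j < 3, adj R i j = false)
    (hsymm : ∀ i < 4, ∀ j < 4, adj R i j = adj R j i) : R = hubRows (enc4 R) := by
  rw [hR]
  unfold hubRows
  refine List.map_congr_left fun i hi => maskOf_congr fun j hj => ?_
  rw [List.mem_range] at hi
  have key : ∀ i < 4, ∀ j < 4, adj R i j = bitOfClass4 (enc4 R) i j := by
    intro i hi j hj
    interval_cases i <;> interval_cases j <;>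
      first
      | exact hdiag _
      | exact hmm _ (by omega) _ (by omega)
      | (simp only [bitOfClass4, enc4, testBit_maskOf]; simp; exact hsymm _ (by omega) _ (by omega))
      | (simp only [bitOfClass4, enc4, testBit_maskOf]; simp)
  rw [← hR]
  exact key i hi j hj

omit hsup hinj hn in
/-- The open rows are their own `maskOf`-rows. -/
theorem oRows_eq_map (ω : Config E) :
    G.oRows ι n ω = (List.range n).map fun i => maskOf n fun j => adj (G.oRows ι n ω) i j := by
  classical
  conv_lhs => unfold oRows
  refine List.map_congr_left fun i hi => maskOf_congr fun j hj => ?_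
  rw [List.mem_range] at hi
  rw [adj_oRows_eq_decide ω hi hj]

omit hsup hinj hn in
/-- The closed rows are their own `maskOf`-rows. -/
theorem cRows_eq_map (ω : Config E) :
    G.cRows ι n ω = (List.range n).map fun i => maskOf n fun j => adj (G.cRows ι n ω) i j := by
  classical
  conv_lhs => unfold cRows
  refine List.map_congr_left fun i hi => maskOf_congr fun j hj => ?_
  rw [List.mem_range] at hi
  rw [adj_cRows_eq_decide ω hi hj]

omit hsup in
/-- No edge joins two marks when every edge is at a non-mark. -/
theorem adj_eq_false_of_marks (hnm : ∀ e, ∃ k, 3 ≤ k ∧ k < n ∧ (G.fst e = ι k ∨ G.snd e = ι k))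
    (ω : Config E) {i j : ℕ} (hi : i < 3) (hj : j < 3) :
    adj (G.oRows ι n ω) i j = false ∧ adj (G.cRows ι n ω) i j = false := by
  have hi' : i < n := by omega
  have hj' : j < n := by omega
  have hno : ∀ e, ¬ G.Joins e (ι i) (ι j) := by
    intro e he
    obtain ⟨k, hk3, hk, hke⟩ := hnm e
    rcases he with ⟨h1, h2⟩ | ⟨h1, h2⟩ <;> rcases hke with hke | hke
    · have := hinj k hk i hi' (hke.symm.trans h1)
      omega
    · have := hinj k hk j hj' (hke.symm.trans h2)
      omega
    · have := hinj k hk j hj' (hke.symm.trans h1)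
      omega
    · have := hinj k hk i hi' (hke.symm.trans h2)
      omega
  constructor
  · cases h : adj (G.oRows ι n ω) i j
    · rfl
    · obtain ⟨_, _, e, _, he⟩ := (adj_oRows ω hi' j).1 h
      exact absurd he (hno e)
  · cases h : adj (G.cRows ι n ω) i j
    · rfl
    · obtain ⟨_, _, e, _, he⟩ := (adj_cRows ω hi' j).1 h
      exact absurd he (hno e)

omit hsup hinj hn in
/-- **The pair gadget**: the D-free inequality on a graph supported on five vertices with every
edge at a non-mark (marks `ι 0, ι 1, ι 2`). -/
theorem dFreeIneq_of_supported5 [Fintype E] [DecidableEq E] (hsup : G.Supported ι 5)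
    (hinj : InjBelow ι 5) (hnm : ∀ e, ∃ k, 3 ≤ k ∧ k < 5 ∧ (G.fst e = ι k ∨ G.snd e = ι k)) :
    G.DFreeIneq (ι 0) (ι 1) (ι 2) := by
  refine dFreeIneq_of_chk hsup hinj (by norm_num) fun ω hbot => ?_
  have hO : G.oRows ι 5 ω = pairRows (enc5 (G.oRows ι 5 ω)) :=
    rows_eq_rows5 _ (oRows_eq_map ω) (adj_oRows_self ω)
      (fun i hi j hj => (adj_eq_false_of_marks hinj (by norm_num) hnm ω hi hj).1)
      (fun i hi j hj => adj_oRows_symm ω hi hj)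
  have hC : G.cRows ι 5 ω = pairRows (enc5 (G.cRows ι 5 ω)) :=
    rows_eq_rows5 _ (cRows_eq_map ω) (adj_cRows_self ω)
      (fun i hi j hj => (adj_eq_false_of_marks hinj (by norm_num) hnm ω hi hj).2)
      (fun i hi j hj => adj_cRows_symm ω hi hj)
  have hbotB : botB 5 (G.oRows ι 5 ω) = true := (isBot_iff_botB hsup hinj (by norm_num)).1 hbot
  have ho : enc5 (G.oRows ι 5 ω) < 128 := maskOf_lt 7 _
  have hc : enc5 (G.cRows ι 5 ω) < 128 := maskOf_lt 7 _
  have hfast : botFast5 (enc5 (G.oRows ι 5 ω)) = true :=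
    botFast5_of_botB _ ho (hO ▸ hbotB)
  have h := chk5_all _ ho _ hc
  unfold chk5 at h
  rw [hfast] at h
  simp only [Bool.not_true, Bool.false_or] at h
  rw [← hO, ← hC] at h
  exact h

omit hsup hinj hn in
/-- **The single hub**: the D-free inequality on a graph supported on four vertices with every edge
at the non-mark `ι 3`. -/
theorem dFreeIneq_of_supported4 [Fintype E] [DecidableEq E] (hsup : G.Supported ι 4)
    (hinj : InjBelow ι 4) (hnm : ∀ e, ∃ k, 3 ≤ k ∧ k < 4 ∧ (G.fst e = ι k ∨ G.snd e = ι k)) :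
    G.DFreeIneq (ι 0) (ι 1) (ι 2) := by
  refine dFreeIneq_of_chk hsup hinj (by norm_num) fun ω _ => ?_
  have hO : G.oRows ι 4 ω = hubRows (enc4 (G.oRows ι 4 ω)) :=
    rows_eq_rows4 _ (oRows_eq_map ω) (adj_oRows_self ω)
      (fun i hi j hj => (adj_eq_false_of_marks hinj (by norm_num) hnm ω hi hj).1)
      (fun i hi j hj => adj_oRows_symm ω hi hj)
  have hC : G.cRows ι 4 ω = hubRows (enc4 (G.cRows ι 4 ω)) :=
    rows_eq_rows4 _ (cRows_eq_map ω) (adj_cRows_self ω)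
      (fun i hi j hj => (adj_eq_false_of_marks hinj (by norm_num) hnm ω hi hj).2)
      (fun i hi j hj => adj_cRows_symm ω hi hj)
  have ho : enc4 (G.oRows ι 4 ω) < 8 := maskOf_lt 3 _
  have hc : enc4 (G.cRows ι 4 ω) < 8 := maskOf_lt 3 _
  have h := chk4_all _ ho _ hc
  unfold chk4 at h
  rw [← hO, ← hC] at h
  exact h

end MultiGraph

end PercRepro
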